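import Mathlib.Analysis.Normed.Group.AddCircle
import Summits.AtomisticToContinuum.HydrodynamicLimit.Theorems.CollisionIsometryCLTHsFreeEnergyConvexBasic
import Literature.Analysis.FluidPDE.HardSphereTorusMeasure
import HarnessLib

/-!
# Grid cubes with a corridor are separated in the minimal-image distance

Helper for support item stmt-AtomisticToContinuum-14870 (`MacroClosure`, line `IdeatorTwoGen1Sketch`),
registered sub-goal `fv_cube_separation` of the sub-cube decomposition behind Ruelle convexity of the
hard-sphere free-energy density.

On the flat unit torus `T3 = UnitAddTorus (Fin 3)` consider the grid `(1/k)ℤ³ / ℤ³` of `k³` points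
`g j := fun l ↦ ((j l / k : ℝ) : UnitAddCircle)`, `j : Fin 3 → Fin k`, and around each grid point the
closed cube of side `s := 1/k - 2m₀` in minimal-image coordinates,
`{x | ∀ l, |reprSym (x - g j) l| ≤ s/2}`. Two points of two *different* cubes are at minimal-image
Euclidean distance `≥ 2m₀`: at a coordinate `l` with `j l ≠ j' l` the two grid points are at
distance `≥ 1/k` on the circle `ℝ/ℤ` (`one_div_le_norm_coe_sub`: `(j l - j' l)/k` is not within
`1/k` of an integer, as `0 < |j l - j' l| < k`), the two points are within `s/2` of their grid
points in that coordinate, and a coordinate of the minimal-image separation vector is bounded by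
its Euclidean norm.

Reference: D. Ruelle, *Statistical Mechanics: Rigorous Results* (1969), §3.4 (sub-cube
decomposition with corridors).
-/

noncomputable section

open MeasureTheory Filter Set Topology
open scoped ENNReal

namespace Summit.AtomisticToContinuum.HydrodynamicLimit.Theorems.MacroClosureLine

open Literature.MathematicalPhysics.KineticTheory Literature.Analysis.FluidPDE
open Literature.Analysis.FunctionSpaces

namespace Barycentric

namespace FvCubeSeparation

/-- Two distinct residues `a ≠ b` modulo `k` give a nonzero integer `a - b - r k` for every
integer `r`. [folklore] -/
theorem natCast_sub_sub_mul_ne_zero {k : ℕ} (a b : Fin k) (hab : a ≠ b) (r : ℤ) :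
    ((a : ℕ) : ℤ) - (b : ℕ) - r * k ≠ 0 := by
  intro h0
  have hk : (0 : ℤ) < k := by exact_mod_cast Fin.pos a
  have ha : ((a : ℕ) : ℤ) < k := by exact_mod_cast a.isLt
  have hb : ((b : ℕ) : ℤ) < k := by exact_mod_cast b.isLt
  have ha0 : (0 : ℤ) ≤ (a : ℕ) := by positivity
  have hb0 : (0 : ℤ) ≤ (b : ℕ) := by positivity
  have hr1 : r < 1 := by
    by_contra h
    have : (k : ℤ) ≤ r * k := le_mul_of_one_le_left hk.le (not_lt.mp h)
    linarith
  have hr2 : -1 < r := by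
    by_contra h
    have : r * (k : ℤ) ≤ -1 * k := mul_le_mul_of_nonneg_right (not_lt.mp h) hk.le
    linarith
  have hr0 : r = 0 := by omega
  subst hr0
  have hab' : (a : ℕ) = (b : ℕ) := by
    have : ((a : ℕ) : ℤ) = (b : ℕ) := by linarith
    exact_mod_cast this
  exact hab (Fin.ext hab')

/-- Two distinct grid points `a/k ≠ b/k` of the circle `ℝ/ℤ` (`a, b < k`) are at distance at least
`1/k`: the distance of `(a - b)/k` to the integers is `|a - b - r k|/k ≥ 1/k` for the nearest
integer `r`, since `a - b - r k ≠ 0`. [folklore] -/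
theorem one_div_le_norm_coe_sub {k : ℕ} (a b : Fin k) (hab : a ≠ b) :
    1 / (k : ℝ) ≤ ‖((((a : ℕ) : ℝ) / k : ℝ) : UnitAddCircle) - ((((b : ℕ) : ℝ) / k : ℝ) : UnitAddCircle)‖ := by
  have hk : (0 : ℝ) < k := by exact_mod_cast Fin.pos a
  have hk0 : (k : ℝ) ≠ 0 := hk.ne'
  rw [← AddCircle.coe_sub, UnitAddCircle.norm_eq]
  set t : ℝ := ((a : ℕ) : ℝ) / k - ((b : ℕ) : ℝ) / k with ht
  set r : ℤ := round t with hr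
  have hz := natCast_sub_sub_mul_ne_zero a b hab r
  have hzt : t - r = ((((a : ℕ) : ℤ) - (b : ℕ) - r * k : ℤ) : ℝ) / k := by
    rw [ht]
    push_cast
    field_simp
  rw [hzt, abs_div, abs_of_pos hk]
  refine div_le_div_of_nonneg_right ?_ hk.le
  exact_mod_cast Int.one_le_abs hz

end FvCubeSeparation

/-- **Grid cubes with a corridor are separated** (registered sub-goal S3a of `stub_ruelleConvexity`):
if `x` lies in the closed cube of side `1/k - 2m₀` (in minimal-image coordinates) around the grid
point `j/k` of the unit `3`-torus and `y` in the one around `j'/k` with `j ≠ j'`, then the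
minimal-image Euclidean distance of `x` and `y` is at least the corridor width `2m₀`. Proof: at a
coordinate `l` with `j l ≠ j' l`, `‖j l/k - j' l/k‖ ≥ 1/k` on `ℝ/ℤ`, the triangle inequality on
the circle and `|reprSym (x - y) l| = ‖x l - y l‖ ≤ ‖reprSym (x - y)‖`. [cite: Ruelle1969, §3.4] -/
theorem fv_cube_separation : ∀ (k : ℕ) (j j' : Fin 3 → Fin k) (m₀ : ℝ) (x y : T3), j ≠ j' → 0 ≤ m₀ →
    2 * m₀ < 1 / (k : ℝ) →
    (∀ l, |Torus.reprSym (x - fun l => (((((j l : ℕ) : ℝ) / k : ℝ)) : UnitAddCircle)) l| ≤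
      (1 / (k : ℝ) - 2 * m₀) / 2) →
    (∀ l, |Torus.reprSym (y - fun l => (((((j' l : ℕ) : ℝ) / k : ℝ)) : UnitAddCircle)) l| ≤
      (1 / (k : ℝ) - 2 * m₀) / 2) →
    2 * m₀ ≤ Torus.euclidDist x y := by
  intro k j j' m₀ x y hjj' _hm₀ _hk hx hy
  obtain ⟨l, hl⟩ := Function.ne_iff.mp hjj'
  -- a coordinate of the minimal-image separation vector is bounded by the distance
  have h1 : |Torus.reprSym (x - y) l| ≤ Torus.euclidDist x y := by
    rw [Torus.euclidDist_eq, ← Real.norm_eq_abs]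
    exact PiLp.norm_apply_le _ l
  rw [Torus.abs_reprSym_apply, Pi.sub_apply] at h1
  have hxl := hx l
  have hyl := hy l
  rw [Torus.abs_reprSym_apply, Pi.sub_apply] at hxl hyl
  -- the two grid points are `≥ 1/k` apart in the coordinate `l`
  have hg := FvCubeSeparation.one_div_le_norm_coe_sub (j l) (j' l) hl
  set a : UnitAddCircle := ((((j l : ℕ) : ℝ) / k : ℝ) : UnitAddCircle) with ha
  set b : UnitAddCircle := ((((j' l : ℕ) : ℝ) / k : ℝ) : UnitAddCircle) with hb
  -- triangle inequality on the circle
  have key : a - b = (x l - y l) + (y l - b) - (x l - a) := by abel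
  have htri : ‖a - b‖ ≤ ‖x l - y l‖ + ‖y l - b‖ + ‖x l - a‖ := by
    rw [key]
    have h₁ := norm_sub_le (x l - y l + (y l - b)) (x l - a)
    have h₂ := norm_add_le (x l - y l) (y l - b)
    linarith
  linarith

end Barycentric

end Summit.AtomisticToContinuum.HydrodynamicLimit.Theorems.MacroClosureLine

end
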